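import Literature.AlgebraicGeometry.Motives.HodgeStructureLefschetzGroupInternalBlocksRestrictionPoints
import Literature.AlgebraicGeometry.Motives.HodgeStructureLefschetzGroupCenterPointsBijection
import HarnessLib

/-!
# THE CENTRE OF `S(A)(K)` BLOCK BY BLOCK, FOR EVERY FIELD `K ⊇ ℚ`: `Z(S(H)(K)) ≅ Π_k Z(S(W_k)(K))` ALONG THE CANONICAL BLOCKS AND
# ALONG REPRESENTATIVES OF THE SIMPLE FACTORS — MILNE'S PROP. 1.5 WITH REMARK 1.6 («`S'(A) ≅ S(A)_{/k'}`») RESTRICTED TO CENTRES,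
# THE CRITERION «CENTRAL IFF CENTRAL ON EVERY BLOCK», `#Z(S(H)(K)) = Π_k #Z(S(W_k)(K))`, AND «ONE BLOCK OF THE SECOND KIND MAKES
# `Z(S(H)(K))` INFINITE» (Milne 1999 §1 Prop. 1.5, Remark 1.6, p. 645 `S₀(A)(R)`; Moonen–Zarhin 1998 §1 Lemma (1))

[topic AlgebraicGeometry/Motives]

Layer `Literature/AlgebraicGeometry/Motives`, lane `lit-hodgefound` (Track 2 foundations library; prover seat
`lit-hodgefound-p02`, generation 55, self-proposed row g55-#5). THEOREMS ONLY: no definition, no named fact (net debt `0`),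
no instance, no notation.  The `K`-points companion of g55-#2 (`Motives/HodgeStructureLefschetzGroupCenterBlocks`, `ℚ`-points).
Milne defines `S(A)(R) = {γ ∈ C(A) ⊗_k R | γ†γ = 1}` and `S₀(A)(R) = {γ ∈ C₀(A) ⊗_ℚ R | γ†γ = 1}` for ALL commutative algebras `R`
(p. 644 L16–L18, p. 645 L4–L6), proves `S(A₁) × ⋯ × S(A_s) ⥲ S(A)` as algebraic groups (Prop. 1.5) and `S'(A) ≅ S(A)_{/k'}`
(Remark 1.6); so for every field `K ⊇ ℚ` the centre of the group of `K`-points is computed block by block.  The tree has Prop. 1.5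
on `K`-points with formulas (g53-#11 `Polarization.exists_mulEquiv_pi_lefschetzGroupBaseChange_of_hom_orthogonal` ∕
`_of_forall_stable` ∕ `_minimal_stable`, g53-#7 `Polarization.exists_mulEquiv_pi_lefschetzGroupBaseChange_of_labelling`); here
they are RESTRICTED TO THE CENTRES (`Subgroup.centerCongr`, `Subgroup.center_pi`):
(i) `Z(S(H)(K)) ≃* Π_k Z(S(W_k, ψ|_{W_k})(K))` with `(ι_k)_K ((f γ)_k x) = γ ((ι_k)_K x)`, along Hom-orthogonal (e.g. `E_φ`-stable)
internal blocks, over the CANONICAL blocks, and along representatives `T_k` of the isotypy classes;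
(ii) the CRITERION: `γ ∈ S(H)(K)` is central iff on each base-changed block it commutes with every element of `S(W_k)(K)`;
(iii) COUNTING: `#Z(S(H)(K)) = Π_k #Z(S(W_k)(K))`, finite iff every block centre is finite, infinite iff some block centre is;
(iv) with g54-#10 (`Polarization.infinite_center_lefschetzGroupBaseChange_of_adjoint_ne` on a block): ONE canonical block on whose
centre `†` is of the second kind makes `Z(S(H)(K))` infinite for every `K`, and a finite `Z(S(H)(K))` forces `†_S` to be of the
first kind on `Z(E_φ(S))` for EVERY canonical block `S`.

## The sources, verbatim

* J. S. Milne, *Lefschetz classes on abelian varieties*, Duke Math. J. 96 (1999) 639–675 [Milne1999LefschetzClasses] (held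
  `paper:doi-10-1215-s0012-7094-99-09620-5`, folios 6–7): p. 644 L16–L18 "for all commutative `k`-algebras `R`, `S(A)(R) =
  {γ ∈ C(A) ⊗_k R | γ†γ = 1}`"; Prop. 1.5 "Any such isogeny induces an isomorphism `S(A₁) × ⋯ × S(A_s) → S(A)`, which is
  independent of the choice of the isogeny"; Remark 1.6 "there are canonical isomorphisms `C'(A) ≅ C(A) ⊗_k k'`,
  `S'(A) ≅ S(A)_{/k'}`"; p. 645 L4–L6 "for all commutative `ℚ`-algebras `R`, `S₀(A)(R) = {γ ∈ C₀(A) ⊗_ℚ R | γ†γ = 1}`";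
  Prop. 1.7 («an isomorphism of algebraic groups `S₀(A)_{/ℚ_ℓ} → S_ℓ(A)` […] we may suppose that `A` is simple»).
* B. J. J. Moonen, Yu. G. Zarhin, *Weil classes on abelian varieties*, J. reine angew. Math. 496 (1998) 83–92
  [MoonenZarhin1998WeilClasses] (held `paper:arxiv-alg-geom_9612017`, chunk p0002): «Lemma. (1) The center of `G_div(X)` is the
  group `U_{K_B}` given by `U_{K_B}(R) = {a ∈ (K_B ⊗_ℚ R)^* ∣ a a† = 1}` […] in all other cases it is finite.»
* H. Lange, *Abelian Varieties over the Complex Numbers* (2023) [Lange2023AbelianVarietiesComplex], §2.4.4 Cor. 2.4.26, §7.2.4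
  Exercise (4).

Nearest tree results, BY NAME: g55-#2 (the `ℚ`-points file), the `S(H)(K)`-level isomorphisms quoted above, g54-#10
`Polarization.infinite_center_lefschetzGroupBaseChange_of_adjoint_ne` ∕ `adjoint_eq_self_of_finite_center_lefschetzGroupBaseChange`.

## Dictionary and what is proved (namespace `Literature.AlgebraicGeometry.Motives.HodgeStructure`)

`S(H)(K) = ψ.lefschetzGroupBaseChange K ≤ GL_K(K ⊗_ℚ V)`, `S(W)(K) = (ψ.restrict W).lefschetzGroupBaseChange K`, `(ι_W)_K =
W.toSubmodule.subtype.baseChange K`, `Z(·) = Subgroup.center`; canonical block = minimal non-zero `E_φ`-stable sub-Hodge structure.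

* §1 **`Polarization.exists_center_lefschetzGroupBaseChange_mulEquiv_pi_of_hom_orthogonal`**, **`…_of_forall_stable`**,
  **`…_minimal_stable`**, **`…_of_labelling`** (`Z(S(H)(K)) ≃* Π_k Z(S(W_k)(K))` with formula).
* §2 **`Polarization.mem_center_lefschetzGroupBaseChange_iff_forall_block_comm`** (the criterion).
* §3 **`Polarization.natCard_center_lefschetzGroupBaseChange_eq_prod`**, **`Polarization.finite_center_lefschetzGroupBaseChange_iff_forall_block`**,
  **`Polarization.infinite_center_lefschetzGroupBaseChange_iff_exists_block`**, **`Polarization.finite_center_lefschetzGroupBaseChange_iff_forall_minimal_stable`**.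
* §4 **`Polarization.infinite_center_lefschetzGroupBaseChange_of_minimal_stable_of_adjoint_ne`** (one block of the second kind ⟹
  infinite), **`Polarization.restrict_adjoint_eq_self_of_finite_center_lefschetzGroupBaseChange`** (finite ⟹ first kind on every block).
-/

noncomputable section

open scoped TensorProduct

namespace Literature.AlgebraicGeometry.Motives

namespace HodgeStructure

universe u uK

variable (K : Type uK) [Field K] [Algebra ℚ K]

/-! ## §0 The centre of a product of groups -/

/-- Along a group isomorphism `e : G ≃* Π_k G_k` the centre of `G` is the product of the centres: `Z(G) ≃* Π_k Z(G_k)`,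
`(f γ)_k = (e γ)_k` (`Subgroup.centerCongr`, `Subgroup.center_pi`). [folklore] -/
private theorem exists_center_mulEquiv_pi_center₅₅₅ {G : Type*} [Group G] {ι : Type*} {M : ι → Type*} [∀ k, Group (M k)]
    (e : G ≃* Π k, M k) :
    ∃ f : Subgroup.center G ≃* Π k, Subgroup.center (M k),
      ∀ (γ : Subgroup.center G) (k : ι), ((f γ k : Subgroup.center (M k)) : M k) = e (γ : G) k := by
  have hmem : ∀ (γ : Subgroup.center G) (k : ι), e (γ : G) k ∈ Subgroup.center (M k) := by
    intro γ k
    have h : e (γ : G) ∈ Subgroup.center (Π k, M k) := (Subgroup.centerCongr e γ).2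
    rw [Subgroup.center_pi, Subgroup.mem_pi] at h
    exact h k (Set.mem_univ k)
  let f₀ : Subgroup.center G →* Π k, Subgroup.center (M k) :=
    { toFun := fun γ k => ⟨e (γ : G) k, hmem γ k⟩
      map_one' := funext fun k => Subtype.ext (by
        change e ((1 : Subgroup.center G) : G) k = 1
        rw [OneMemClass.coe_one, map_one, Pi.one_apply])
      map_mul' := fun γ γ' => funext fun k => Subtype.ext (by
        change e ((γ * γ' : Subgroup.center G) : G) k = e (γ : G) k * e (γ' : G) k
        rw [Subgroup.coe_mul, map_mul, Pi.mul_apply]) }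
  have hf₀ : ∀ (γ : Subgroup.center G) (k : ι), ((f₀ γ k : Subgroup.center (M k)) : M k) = e (γ : G) k := fun _ _ => rfl
  refine ⟨MulEquiv.ofBijective f₀ ⟨fun γ γ' h => ?_, fun δ => ?_⟩, hf₀⟩
  · apply Subtype.ext
    apply e.injective
    funext k
    rw [← hf₀ γ k, ← hf₀ γ' k, h]
  · have hδ : (fun k => ((δ k : Subgroup.center (M k)) : M k)) ∈ Subgroup.center (Π k, M k) := by
      rw [Subgroup.center_pi, Subgroup.mem_pi]
      exact fun k _ => (δ k).2
    refine ⟨(Subgroup.centerCongr e).symm ⟨_, hδ⟩, funext fun k => Subtype.ext ?_⟩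
    rw [hf₀]
    change e ((e.symm fun k => ((δ k : Subgroup.center (M k)) : M k)) : G) k = _
    rw [MulEquiv.apply_symm_apply]

/-! ## §1 `Z(S(H)(K)) ≃* Π_k Z(S(W_k)(K))` along internal blocks -/

section Blocks

variable {V : Type u} [AddCommGroup V] [Module ℚ V] [Module.Finite ℚ V] {n : ℤ} {H : HodgeStructure V n} (ψ : Polarization H)
  {κ : Type*} [Fintype κ] [DecidableEq κ] (W : κ → SubHodgeStructure H) (hW : DirectSum.IsInternal fun k => (W k).toSubmodule)

include hW

/-- **THE CENTRE OF `S(H)(K)` BLOCK BY BLOCK — Hom-orthogonal blocks, every field `K ⊇ ℚ`**: restriction to the base-changed blocks is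
a group isomorphism `Z(S(H, ψ)(K)) ≃* Π_k Z(S(W_k, ψ|_{W_k})(K))`, `(ι_k)_K ((f γ)_k x) = γ ((ι_k)_K x)` (g53-#11's
`S(H)(K) ≃* Π_k S(W_k)(K)` restricted to centres). [cite: Milne1999LefschetzClasses, §1 Prop. 1.5, Remark 1.6 (p. 644) and p. 645 L4–L6 (S₀(A)(R))]
[cite: Lange2023AbelianVarietiesComplex, §7.2.4 Exercise (4)] -/
theorem Polarization.exists_center_lefschetzGroupBaseChange_mulEquiv_pi_of_hom_orthogonal
    (horth : ∀ k l, k ≠ l → ∀ f : Hom (W k).toHodgeStructure (W l).toHodgeStructure, f = 0) :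
    ∃ f : Subgroup.center (ψ.lefschetzGroupBaseChange K) ≃* Π k, Subgroup.center ((ψ.restrict (W k)).lefschetzGroupBaseChange K),
      ∀ (γ : Subgroup.center (ψ.lefschetzGroupBaseChange K)) (k : κ) (x : K ⊗[ℚ] (W k).toSubmodule),
        (W k).toSubmodule.subtype.baseChange K
            ((((f γ k : Subgroup.center ((ψ.restrict (W k)).lefschetzGroupBaseChange K)) :
              (ψ.restrict (W k)).lefschetzGroupBaseChange K) :
                (K ⊗[ℚ] (W k).toSubmodule) ≃ₗ[K] (K ⊗[ℚ] (W k).toSubmodule)) x) =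
          ((γ : ψ.lefschetzGroupBaseChange K) : (K ⊗[ℚ] V) ≃ₗ[K] (K ⊗[ℚ] V)) ((W k).toSubmodule.subtype.baseChange K x) := by
  obtain ⟨F, hF⟩ := ψ.exists_mulEquiv_pi_lefschetzGroupBaseChange_of_hom_orthogonal K W hW horth
  obtain ⟨f, hf⟩ := exists_center_mulEquiv_pi_center₅₅₅ F
  refine ⟨f, fun γ k x => ?_⟩
  rw [hf, hF]

/-- **THE CENTRE OF `S(H)(K)` BLOCK BY BLOCK — `E_φ`-stable blocks** (these are Hom-orthogonal).
[cite: Milne1999LefschetzClasses, §1 Prop. 1.5, Remark 1.6 (p. 644) and p. 645 L4–L6] [cite: Lange2023AbelianVarietiesComplex, §7.2.4 Exercise (4)] -/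
theorem Polarization.exists_center_lefschetzGroupBaseChange_mulEquiv_pi_of_forall_stable
    (hst : ∀ k, ∀ a ∈ H.endAlg, ∀ v ∈ (W k).toSubmodule, a v ∈ (W k).toSubmodule) :
    ∃ f : Subgroup.center (ψ.lefschetzGroupBaseChange K) ≃* Π k, Subgroup.center ((ψ.restrict (W k)).lefschetzGroupBaseChange K),
      ∀ (γ : Subgroup.center (ψ.lefschetzGroupBaseChange K)) (k : κ) (x : K ⊗[ℚ] (W k).toSubmodule),
        (W k).toSubmodule.subtype.baseChange K
            ((((f γ k : Subgroup.center ((ψ.restrict (W k)).lefschetzGroupBaseChange K)) :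
              (ψ.restrict (W k)).lefschetzGroupBaseChange K) :
                (K ⊗[ℚ] (W k).toSubmodule) ≃ₗ[K] (K ⊗[ℚ] (W k).toSubmodule)) x) =
          ((γ : ψ.lefschetzGroupBaseChange K) : (K ⊗[ℚ] V) ≃ₗ[K] (K ⊗[ℚ] V)) ((W k).toSubmodule.subtype.baseChange K x) :=
  ψ.exists_center_lefschetzGroupBaseChange_mulEquiv_pi_of_hom_orthogonal K W hW fun _ _ hkl f =>
    hom_eq_zero_of_forall_stable W hW hst hkl f

/-! ## §2 The criterion on `K`-points -/

omit hW [Fintype κ] [DecidableEq κ] [Module.Finite ℚ V] in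
/-- `(ι_k)_K : K ⊗ W_k → K ⊗ V` is injective (`K` is flat over `ℚ`). [folklore] -/
private theorem subtype_baseChange_injective₅₅₅ (k : κ) : Function.Injective ((W k).toSubmodule.subtype.baseChange K) := by
  rw [LinearMap.baseChange_eq_ltensor]
  exact Module.Flat.lTensor_preserves_injective_linearMap _ (W k).toSubmodule.injective_subtype

/-- **`γ ∈ S(H)(K)` IS CENTRAL IFF, ON EACH BASE-CHANGED BLOCK `K ⊗ W_k`, IT COMMUTES WITH EVERY ELEMENT OF `S(W_k)(K)`** (Hom-orthogonal
internal blocks): with `γ_k ∈ S(W_k)(K)` the restriction of `γ` (`(ι_k)_K ∘ γ_k = γ ∘ (ι_k)_K`), `γ` is central iff `γ_k δ = δ γ_k` for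
all `δ ∈ S(W_k)(K)` and all `k` — centrality is tested factor by factor along `S(H)(K) ≃* Π_k S(W_k)(K)`.
[cite: Milne1999LefschetzClasses, §1 Prop. 1.5, Remark 1.6 (p. 644) and p. 645 L4–L6] [cite: Lange2023AbelianVarietiesComplex, §7.2.4 Exercise (4)] -/
theorem Polarization.mem_center_lefschetzGroupBaseChange_iff_forall_block_comm
    (horth : ∀ k l, k ≠ l → ∀ f : Hom (W k).toHodgeStructure (W l).toHodgeStructure, f = 0)
    (γ : ψ.lefschetzGroupBaseChange K) :
    γ ∈ Subgroup.center (ψ.lefschetzGroupBaseChange K) ↔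
      ∀ (k : κ) (γk : (K ⊗[ℚ] (W k).toSubmodule) ≃ₗ[K] (K ⊗[ℚ] (W k).toSubmodule)),
        (∀ x, (W k).toSubmodule.subtype.baseChange K (γk x) =
          (γ : (K ⊗[ℚ] V) ≃ₗ[K] (K ⊗[ℚ] V)) ((W k).toSubmodule.subtype.baseChange K x)) →
        ∀ δ : (K ⊗[ℚ] (W k).toSubmodule) ≃ₗ[K] (K ⊗[ℚ] (W k).toSubmodule), δ ∈ (ψ.restrict (W k)).lefschetzGroupBaseChange K →
          ∀ x, γk (δ x) = δ (γk x) := by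
  obtain ⟨F, hF⟩ := ψ.exists_mulEquiv_pi_lefschetzGroupBaseChange_of_hom_orthogonal K W hW horth
  -- any `γk` over `γ` on the block `k` IS the `k`-th restriction `(F γ) k`
  have hγk : ∀ (g : ψ.lefschetzGroupBaseChange K) (k : κ) (γk : (K ⊗[ℚ] (W k).toSubmodule) ≃ₗ[K] (K ⊗[ℚ] (W k).toSubmodule)),
      (∀ x, (W k).toSubmodule.subtype.baseChange K (γk x) =
        (g : (K ⊗[ℚ] V) ≃ₗ[K] (K ⊗[ℚ] V)) ((W k).toSubmodule.subtype.baseChange K x)) →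
      γk = (F g k : (K ⊗[ℚ] (W k).toSubmodule) ≃ₗ[K] (K ⊗[ℚ] (W k).toSubmodule)) := by
    intro g k γk h
    refine LinearEquiv.ext fun x => subtype_baseChange_injective₅₅₅ K W k ?_
    rw [h, hF]
  constructor
  · intro hγ k γk hk δ hδ x
    rw [hγk γ k γk hk]
    -- `δ` on `W_k`, `1` elsewhere, is `F g` for some `g`; `γ g = g γ`
    obtain ⟨g, hg⟩ := F.surjective (Pi.mulSingle k ⟨δ, hδ⟩)
    have hgk : (F g k : (K ⊗[ℚ] (W k).toSubmodule) ≃ₗ[K] (K ⊗[ℚ] (W k).toSubmodule)) = δ := by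
      rw [hg, Pi.mulSingle_eq_same]
    have hcomm : F γ k * F g k = F g k * F γ k := by
      rw [← Pi.mul_apply, ← Pi.mul_apply, ← map_mul, ← map_mul, Subgroup.mem_center_iff.1 hγ g]
    have h2 := congrArg (fun y : (ψ.restrict (W k)).lefschetzGroupBaseChange K =>
      (y : (K ⊗[ℚ] (W k).toSubmodule) ≃ₗ[K] (K ⊗[ℚ] (W k).toSubmodule)) x) hcomm
    simp only [Subgroup.coe_mul, LinearEquiv.mul_apply] at h2
    rw [hgk] at h2
    exact h2
  · intro h
    rw [Subgroup.mem_center_iff]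
    intro g
    apply F.injective
    rw [map_mul, map_mul]
    funext k
    rw [Pi.mul_apply, Pi.mul_apply]
    apply Subtype.ext
    rw [Subgroup.coe_mul, Subgroup.coe_mul]
    apply LinearEquiv.ext
    intro x
    rw [LinearEquiv.mul_apply, LinearEquiv.mul_apply]
    exact (h k _ (fun x => hF γ k x) _ (F g k).2 x).symm

/-! ## §3 Counting on `K`-points -/

/-- **`#Z(S(H)(K)) = Π_k #Z(S(W_k)(K))`** along Hom-orthogonal internal blocks, for every field `K ⊇ ℚ` (as `Nat.card`; a block with
infinite centre makes both sides `0`). [cite: Milne1999LefschetzClasses, §1 Prop. 1.5, Remark 1.6 (p. 644), p. 645 L4–L14 and §2 Summary p. 652]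
[cite: MoonenZarhin1998WeilClasses, §1 Lemma (1)] -/
theorem Polarization.natCard_center_lefschetzGroupBaseChange_eq_prod
    (horth : ∀ k l, k ≠ l → ∀ f : Hom (W k).toHodgeStructure (W l).toHodgeStructure, f = 0) :
    Nat.card (Subgroup.center (ψ.lefschetzGroupBaseChange K)) =
      ∏ k, Nat.card (Subgroup.center ((ψ.restrict (W k)).lefschetzGroupBaseChange K)) := by
  obtain ⟨f, -⟩ := ψ.exists_center_lefschetzGroupBaseChange_mulEquiv_pi_of_hom_orthogonal K W hW horth
  rw [Nat.card_congr f.toEquiv, Nat.card_pi]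

/-- **`Z(S(H)(K))` IS FINITE IFF EVERY BLOCK CENTRE `Z(S(W_k)(K))` IS FINITE** (Hom-orthogonal internal blocks, every field `K ⊇ ℚ`).
[cite: Milne1999LefschetzClasses, §1 Prop. 1.5, Remark 1.6 (p. 644) and §2 Summary p. 652] [cite: MoonenZarhin1998WeilClasses, §1 Lemma (1)] -/
theorem Polarization.finite_center_lefschetzGroupBaseChange_iff_forall_block
    (horth : ∀ k l, k ≠ l → ∀ f : Hom (W k).toHodgeStructure (W l).toHodgeStructure, f = 0) :
    Finite (Subgroup.center (ψ.lefschetzGroupBaseChange K)) ↔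
      ∀ k, Finite (Subgroup.center ((ψ.restrict (W k)).lefschetzGroupBaseChange K)) := by
  obtain ⟨f, -⟩ := ψ.exists_center_lefschetzGroupBaseChange_mulEquiv_pi_of_hom_orthogonal K W hW horth
  rw [Equiv.finite_iff f.toEquiv]
  constructor
  · intro h k
    exact Finite.of_surjective (fun x : Π k, Subgroup.center ((ψ.restrict (W k)).lefschetzGroupBaseChange K) => x k)
      fun y => ⟨Function.update (fun _ => 1) k y, by simp only [Function.update_self]⟩
  · intro h
    exact Pi.finite

/-- **`Z(S(H)(K))` IS INFINITE IFF SOME BLOCK CENTRE `Z(S(W_k)(K))` IS INFINITE** (Hom-orthogonal internal blocks, every field `K ⊇ ℚ`).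
[cite: Milne1999LefschetzClasses, §1 Prop. 1.5, Remark 1.6 (p. 644) and §2 Summary p. 652] [cite: MoonenZarhin1998WeilClasses, §1 Lemma (1)] -/
theorem Polarization.infinite_center_lefschetzGroupBaseChange_iff_exists_block
    (horth : ∀ k l, k ≠ l → ∀ f : Hom (W k).toHodgeStructure (W l).toHodgeStructure, f = 0) :
    Infinite (Subgroup.center (ψ.lefschetzGroupBaseChange K)) ↔
      ∃ k, Infinite (Subgroup.center ((ψ.restrict (W k)).lefschetzGroupBaseChange K)) := by
  rw [← not_finite_iff_infinite, ψ.finite_center_lefschetzGroupBaseChange_iff_forall_block K W hW horth, not_forall]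
  exact exists_congr fun k => not_finite_iff_infinite

end Blocks

/-! ## §4 The canonical blocks and the representatives; one block of the second kind -/

section Canonical

variable {V : Type u} [AddCommGroup V] [Module ℚ V] [Module.Finite ℚ V] {n : ℤ} {H : HodgeStructure V n}

open Classical in
/-- **`Z(S(H)(K)) ≃* Π_S Z(S(S, ψ|_S)(K))` OVER THE CANONICAL BLOCKS, EVERY FIELD `K ⊇ ℚ`**, with `(ι_S)_K ((f γ)_S x) = γ ((ι_S)_K x)`
— «`S₀(A)(R)`» computed simple factor by simple factor, uniformly in the coefficient field (Remark 1.6).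
[cite: Milne1999LefschetzClasses, §1 Prop. 1.5, Remark 1.6 (p. 644) and p. 645 L4–L14] [cite: Lange2023AbelianVarietiesComplex, §2.4.4 Cor. 2.4.26 and §7.2.4 Exercise (4)] -/
theorem Polarization.exists_center_lefschetzGroupBaseChange_mulEquiv_pi_minimal_stable (ψ : Polarization H) :
    ∃ f : Subgroup.center (ψ.lefschetzGroupBaseChange K) ≃*
        Π S : {S : SubHodgeStructure H // (∀ a ∈ H.endAlg, ∀ v ∈ S.toSubmodule, a v ∈ S.toSubmodule) ∧ S.toSubmodule ≠ ⊥ ∧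
          ∀ S' : SubHodgeStructure H, (∀ a ∈ H.endAlg, ∀ v ∈ S'.toSubmodule, a v ∈ S'.toSubmodule) →
            S'.toSubmodule ≤ S.toSubmodule → S'.toSubmodule = ⊥ ∨ S'.toSubmodule = S.toSubmodule},
          Subgroup.center ((ψ.restrict (S : SubHodgeStructure H)).lefschetzGroupBaseChange K),
      ∀ (γ : Subgroup.center (ψ.lefschetzGroupBaseChange K))
        (S : {S : SubHodgeStructure H // (∀ a ∈ H.endAlg, ∀ v ∈ S.toSubmodule, a v ∈ S.toSubmodule) ∧ S.toSubmodule ≠ ⊥ ∧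
          ∀ S' : SubHodgeStructure H, (∀ a ∈ H.endAlg, ∀ v ∈ S'.toSubmodule, a v ∈ S'.toSubmodule) →
            S'.toSubmodule ≤ S.toSubmodule → S'.toSubmodule = ⊥ ∨ S'.toSubmodule = S.toSubmodule})
        (x : K ⊗[ℚ] (S : SubHodgeStructure H).toSubmodule),
        (S : SubHodgeStructure H).toSubmodule.subtype.baseChange K
            ((((f γ S : Subgroup.center ((ψ.restrict (S : SubHodgeStructure H)).lefschetzGroupBaseChange K)) :
              (ψ.restrict (S : SubHodgeStructure H)).lefschetzGroupBaseChange K) :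
                (K ⊗[ℚ] (S : SubHodgeStructure H).toSubmodule) ≃ₗ[K] (K ⊗[ℚ] (S : SubHodgeStructure H).toSubmodule)) x) =
          ((γ : ψ.lefschetzGroupBaseChange K) : (K ⊗[ℚ] V) ≃ₗ[K] (K ⊗[ℚ] V))
            ((S : SubHodgeStructure H).toSubmodule.subtype.baseChange K x) := by
  haveI : Fintype {S : SubHodgeStructure H // (∀ a ∈ H.endAlg, ∀ v ∈ S.toSubmodule, a v ∈ S.toSubmodule) ∧ S.toSubmodule ≠ ⊥ ∧
      ∀ S' : SubHodgeStructure H, (∀ a ∈ H.endAlg, ∀ v ∈ S'.toSubmodule, a v ∈ S'.toSubmodule) →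
        S'.toSubmodule ≤ S.toSubmodule → S'.toSubmodule = ⊥ ∨ S'.toSubmodule = S.toSubmodule} :=
    ψ.finite_setOf_minimal_stable.fintype
  exact ψ.exists_center_lefschetzGroupBaseChange_mulEquiv_pi_of_hom_orthogonal K
    (Subtype.val : {S : SubHodgeStructure H // (∀ a ∈ H.endAlg, ∀ v ∈ S.toSubmodule, a v ∈ S.toSubmodule) ∧ S.toSubmodule ≠ ⊥ ∧
      ∀ S' : SubHodgeStructure H, (∀ a ∈ H.endAlg, ∀ v ∈ S'.toSubmodule, a v ∈ S'.toSubmodule) →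
        S'.toSubmodule ≤ S.toSubmodule → S'.toSubmodule = ⊥ ∨ S'.toSubmodule = S.toSubmodule} → SubHodgeStructure H)
    ψ.isInternal_minimal_stable
    fun S S' hne f => ψ.hom_eq_zero_of_minimal_stable_of_ne S.2 S'.2 (fun h => hne (Subtype.ext h)) f

/-- **`Z(S(H)(K))` IS FINITE IFF `Z(S(S, ψ|_S)(K))` IS FINITE FOR EVERY CANONICAL BLOCK `S`**, every field `K ⊇ ℚ`.
[cite: Milne1999LefschetzClasses, §1 Prop. 1.5, Remark 1.6 (p. 644) and §2 Summary p. 652] [cite: MoonenZarhin1998WeilClasses, §1 Lemma (1)] -/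
theorem Polarization.finite_center_lefschetzGroupBaseChange_iff_forall_minimal_stable (ψ : Polarization H) :
    Finite (Subgroup.center (ψ.lefschetzGroupBaseChange K)) ↔
      ∀ S : SubHodgeStructure H, ((∀ a ∈ H.endAlg, ∀ v ∈ S.toSubmodule, a v ∈ S.toSubmodule) ∧ S.toSubmodule ≠ ⊥ ∧
        ∀ S' : SubHodgeStructure H, (∀ a ∈ H.endAlg, ∀ v ∈ S'.toSubmodule, a v ∈ S'.toSubmodule) →
          S'.toSubmodule ≤ S.toSubmodule → S'.toSubmodule = ⊥ ∨ S'.toSubmodule = S.toSubmodule) →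
        Finite (Subgroup.center ((ψ.restrict S).lefschetzGroupBaseChange K)) := by
  classical
  haveI : Fintype {S : SubHodgeStructure H // (∀ a ∈ H.endAlg, ∀ v ∈ S.toSubmodule, a v ∈ S.toSubmodule) ∧ S.toSubmodule ≠ ⊥ ∧
      ∀ S' : SubHodgeStructure H, (∀ a ∈ H.endAlg, ∀ v ∈ S'.toSubmodule, a v ∈ S'.toSubmodule) →
        S'.toSubmodule ≤ S.toSubmodule → S'.toSubmodule = ⊥ ∨ S'.toSubmodule = S.toSubmodule} :=
    ψ.finite_setOf_minimal_stable.fintype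
  rw [ψ.finite_center_lefschetzGroupBaseChange_iff_forall_block K
    (Subtype.val : {S : SubHodgeStructure H // (∀ a ∈ H.endAlg, ∀ v ∈ S.toSubmodule, a v ∈ S.toSubmodule) ∧ S.toSubmodule ≠ ⊥ ∧
      ∀ S' : SubHodgeStructure H, (∀ a ∈ H.endAlg, ∀ v ∈ S'.toSubmodule, a v ∈ S'.toSubmodule) →
        S'.toSubmodule ≤ S.toSubmodule → S'.toSubmodule = ⊥ ∨ S'.toSubmodule = S.toSubmodule} → SubHodgeStructure H)
    ψ.isInternal_minimal_stable
    fun S S' hne f => ψ.hom_eq_zero_of_minimal_stable_of_ne S.2 S'.2 (fun h => hne (Subtype.ext h)) f]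
  exact ⟨fun h S hS => h ⟨S, hS⟩, fun h S => h S.1 S.2⟩

/-- **ONE CANONICAL BLOCK OF THE SECOND KIND MAKES `Z(S(H)(K))` INFINITE FOR EVERY FIELD `K ⊇ ℚ`**: if `†_S` moves some central Hodge
endomorphism of a canonical block `S` (type IV on that simple factor), then `Z(S(S, ψ|_S)(K))` is infinite (g54-#10 on the block)
and so is `Z(S(H)(K)) ≅ Π_{S'} Z(S(S')(K))`. [cite: Milne1999LefschetzClasses, §1 Prop. 1.5, Remark 1.6 (p. 644) and §2 Summary p. 652 (IV: not semisimple)]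
[cite: MoonenZarhin1998WeilClasses, §1 Lemma (1)] [cite: Lange2023AbelianVarietiesComplex, §2.6.2 Lemma 2.6.6] -/
theorem Polarization.infinite_center_lefschetzGroupBaseChange_of_minimal_stable_of_adjoint_ne (ψ : Polarization H)
    {S : SubHodgeStructure H}
    (hS : (∀ a ∈ H.endAlg, ∀ v ∈ S.toSubmodule, a v ∈ S.toSubmodule) ∧ S.toSubmodule ≠ ⊥ ∧
      ∀ S' : SubHodgeStructure H, (∀ a ∈ H.endAlg, ∀ v ∈ S'.toSubmodule, a v ∈ S'.toSubmodule) →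
        S'.toSubmodule ≤ S.toSubmodule → S'.toSubmodule = ⊥ ∨ S'.toSubmodule = S.toSubmodule)
    {z₀ : S.toHodgeStructure.endAlg} (hz₀ : z₀ ∈ Subalgebra.center ℚ S.toHodgeStructure.endAlg)
    (hne : (ψ.restrict S).adjoint (z₀ : Module.End ℚ S.toSubmodule) ≠ z₀) :
    Infinite (Subgroup.center (ψ.lefschetzGroupBaseChange K)) := by
  rw [← not_finite_iff_infinite, ψ.finite_center_lefschetzGroupBaseChange_iff_forall_minimal_stable K, not_forall]
  refine ⟨S, fun h => ?_⟩
  haveI := (ψ.restrict S).infinite_center_lefschetzGroupBaseChange_of_adjoint_ne K hz₀ hne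
  haveI := h hS
  exact not_finite (Subgroup.center ((ψ.restrict S).lefschetzGroupBaseChange K))

/-- **A FINITE `Z(S(H)(K))` FORCES `†_S` TO BE OF THE FIRST KIND ON `Z(E_φ(S))` FOR EVERY CANONICAL BLOCK `S`** (every field `K ⊇ ℚ`;
contrapositive of the previous statement). [cite: Milne1999LefschetzClasses, §1 Prop. 1.5, p. 645 L1–L6 and §2 Summary p. 652]
[cite: MoonenZarhin1998WeilClasses, §1 Lemma (1)] [cite: Lange2023AbelianVarietiesComplex, §2.6.2 Lemma 2.6.4] -/
theorem Polarization.restrict_adjoint_eq_self_of_finite_center_lefschetzGroupBaseChange (ψ : Polarization H)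
    [Finite (Subgroup.center (ψ.lefschetzGroupBaseChange K))] {S : SubHodgeStructure H}
    (hS : (∀ a ∈ H.endAlg, ∀ v ∈ S.toSubmodule, a v ∈ S.toSubmodule) ∧ S.toSubmodule ≠ ⊥ ∧
      ∀ S' : SubHodgeStructure H, (∀ a ∈ H.endAlg, ∀ v ∈ S'.toSubmodule, a v ∈ S'.toSubmodule) →
        S'.toSubmodule ≤ S.toSubmodule → S'.toSubmodule = ⊥ ∨ S'.toSubmodule = S.toSubmodule)
    {z : S.toHodgeStructure.endAlg} (hz : z ∈ Subalgebra.center ℚ S.toHodgeStructure.endAlg) :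
    (ψ.restrict S).adjoint (z : Module.End ℚ S.toSubmodule) = z := by
  by_contra hne
  haveI := ψ.infinite_center_lefschetzGroupBaseChange_of_minimal_stable_of_adjoint_ne K hS hz hne
  exact not_finite (Subgroup.center (ψ.lefschetzGroupBaseChange K))

end Canonical

section Labelled

variable {V : Type u} [AddCommGroup V] [Module ℚ V] [Module.Finite ℚ V] {n : ℤ} {H : HodgeStructure V n}
  {ι : Type*} [Fintype ι] [DecidableEq ι] (T : ι → SubHodgeStructure H)
  (hT : DirectSum.IsInternal fun i => (T i).toSubmodule) {κ : Finset ι} {c : ι → κ}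
  (hc : ∀ i, ∃ g : Hom (T i).toHodgeStructure (T (c i)).toHodgeStructure, Function.Bijective g.toLinearMap)
  (hκ : ∀ k k' : κ, (∃ g : Hom (T k).toHodgeStructure (T k').toHodgeStructure,
    Function.Bijective g.toLinearMap) → k = k')

include hT hc hκ

/-- **«`S(A₁) × ⋯ × S(A_s) → S(A)` IS AN ISOMORPHISM» ON THE CENTRES OF THE `K`-POINTS: `Z(S(H)(K)) ≃* Π_{k ∈ κ} Z(S(T_k, ψ|_{T_k})(K))`
along REPRESENTATIVES `T_k` of the irreducible isotypy classes**, `(ι_k)_K ((f γ)_k x) = γ ((ι_k)_K x)` (g53-#7 restricted to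
centres) — «we may suppose that `A` is simple», for every coefficient field. [cite: Milne1999LefschetzClasses, §1 Prop. 1.5, Remark 1.6 (p. 644) and p. 645 L8–L14 (Prop. 1.7)]
[cite: Lange2023AbelianVarietiesComplex, §2.4.4 Cor. 2.4.26 and §7.2.4 Exercise (4)] -/
theorem Polarization.exists_center_lefschetzGroupBaseChange_mulEquiv_pi_of_labelling (ψ : Polarization H)
    (hirr : ∀ i, (T i).toHodgeStructure.IsIrreducible) :
    ∃ f : Subgroup.center (ψ.lefschetzGroupBaseChange K) ≃*
        Π k : κ, Subgroup.center ((ψ.restrict (T k)).lefschetzGroupBaseChange K),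
      ∀ (γ : Subgroup.center (ψ.lefschetzGroupBaseChange K)) (k : κ) (x : K ⊗[ℚ] (T k).toSubmodule),
        (T k).toSubmodule.subtype.baseChange K
            ((((f γ k : Subgroup.center ((ψ.restrict (T k)).lefschetzGroupBaseChange K)) :
              (ψ.restrict (T k)).lefschetzGroupBaseChange K) :
                (K ⊗[ℚ] (T k).toSubmodule) ≃ₗ[K] (K ⊗[ℚ] (T k).toSubmodule)) x) =
          ((γ : ψ.lefschetzGroupBaseChange K) : (K ⊗[ℚ] V) ≃ₗ[K] (K ⊗[ℚ] V)) ((T k).toSubmodule.subtype.baseChange K x) := by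
  obtain ⟨F, hF⟩ := ψ.exists_mulEquiv_pi_lefschetzGroupBaseChange_of_labelling K T hT hc hκ hirr
  obtain ⟨f, hf⟩ := exists_center_mulEquiv_pi_center₅₅₅ F
  refine ⟨f, fun γ k x => ?_⟩
  rw [hf, hF]

/-- **`#Z(S(H)(K)) = Π_{k ∈ κ} #Z(S(T_k)(K))` over representatives of the simple factors**, every field `K ⊇ ℚ` (as `Nat.card`).
[cite: Milne1999LefschetzClasses, §1 Prop. 1.5, Remark 1.6 (p. 644) and §2 Summary p. 652] [cite: MoonenZarhin1998WeilClasses, §1 Lemma (1)] -/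
theorem Polarization.natCard_center_lefschetzGroupBaseChange_eq_prod_of_labelling (ψ : Polarization H)
    (hirr : ∀ i, (T i).toHodgeStructure.IsIrreducible) :
    Nat.card (Subgroup.center (ψ.lefschetzGroupBaseChange K)) =
      ∏ k : κ, Nat.card (Subgroup.center ((ψ.restrict (T k)).lefschetzGroupBaseChange K)) := by
  obtain ⟨f, -⟩ := ψ.exists_center_lefschetzGroupBaseChange_mulEquiv_pi_of_labelling K T hT hc hκ hirr
  rw [Nat.card_congr f.toEquiv, Nat.card_pi]

end Labelled

end HodgeStructure

end Literature.AlgebraicGeometry.Motives
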